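import Summits.HodgeConjecture.HodgeConjecture.Theses.NoetherLefschetzOneUp
import Literature.AlgebraicGeometry.HodgeTheory.MiddleDimensionReductionHolds

/-!
# Route NoetherLefschetzOneUp — support item `MiddleReduction` (stmt-HodgeConjecture-11624)

The route's support item `MiddleReduction` is, verbatim, the definiens of the Literature named fact
`Literature.AlgebraicGeometry.HodgeTheory.middleDimensionReduction` (Brosnan–Fang–Nie–Pearlstein
2009, §6 Lemma 48: if every rational middle-degree Hodge class on every even-dimensional smooth
projective complex variety is algebraic, then every rational `(p,p)`-class on every smooth
projective complex variety is algebraic — products with projective spaces below the middle,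
general linear sections / weak Lefschetz above it).

That fact is DISCHARGED in the tree, unconditionally:
`Literature.AlgebraicGeometry.HodgeTheory.middleDimensionReduction_holds`
(`MiddleDimensionReductionHolds.lean`: the formalised printed proof
`middleDimensionReduction_of_exists_deRhamIsoFamily` fed with the theorems
`nonempty_hodgeModel_holds`, `hodgePQ_independent_of_hodgeModel_holds` and de Rham's theorem
`Literature.NumberTheory.Transcendental.exists_deRhamIsoFamily_holds`). So the item closes by
unfolding the route definition and quoting the discharged fact; no hypotheses, no named facts in
the cone (`#print axioms`: `propext`, `Classical.choice`, `Quot.sound`).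

## References

* P. Brosnan, H. Fang, Z. Nie, G. Pearlstein, *Singularities of admissible normal functions*,
  Invent. Math. 177 (2009), §6, Lemma 48 (arXiv:0711.0964, p. 13). [BrosnanFangNiePearlstein2009]
-/

noncomputable section

-- `Summit.HodgeConjecture.HodgeConjecture.Theorems` is the mandated namespace (single-problem summit:
-- Problem = Summit), which `linter.dupNamespace` flags on every declaration; the lakefile turns the
-- linter off tree-wide (weak option), restated here so stand-alone elaboration is warning-free too.
set_option linter.dupNamespace false

namespace Summit.HodgeConjecture.HodgeConjecture.Theorems

/-- **Support item `MiddleReduction` of route NoetherLefschetzOneUp holds** (BFNP Lemma 48,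
reduction of the Hodge conjecture to the middle degree of even-dimensional varieties): if every
rational `(m,m)`-class on every smooth projective complex `2m`-fold lies in `algebraicClasses X m`,
then every rational `(p,p)`-class on every smooth projective complex variety of any dimension `n`
lies in `algebraicClasses X p`. Proof: the route definition unfolds to the Literature named fact
`middleDimensionReduction`, discharged unconditionally by `middleDimensionReduction_holds`.
[cite: BrosnanFangNiePearlstein2009, §6 Lemma 48] -/
theorem middleReduction_proof :
    Summit.HodgeConjecture.HodgeConjecture.Theses.NoetherLefschetzOneUp.MiddleReduction := by
  unfold Summit.HodgeConjecture.HodgeConjecture.Theses.NoetherLefschetzOneUp.MiddleReduction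
  exact Literature.AlgebraicGeometry.HodgeTheory.middleDimensionReduction_holds

end Summit.HodgeConjecture.HodgeConjecture.Theorems

end
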